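import Summits.BirchSwinnertonDyer.Rank1Residual.Supersingular.CountPointsFast
import Summits.BirchSwinnertonDyer.Rank1Residual.Supersingular.X6KuriharaOfferShape
import Summits.BirchSwinnertonDyer.Rank1Residual.Supersingular.X6RankOneOneSided
import Summits.BirchSwinnertonDyer.Rank1Residual.SecondDescent.CanaryTargetsClassCertificates
import Summits.BirchSwinnertonDyer.Rank1Residual.X11b.KrausMinimalityGeneralTwo
import HarnessLib

/-!
# Route `SignedLowerHalves`, crux `KobayashiLowerHalfSemistable` (item stmt-BirchSwinnertonDyer-19000), literal row D2
# (`JSW-ss`) — the RE-ROUTE of X6 ∩ {r = 1} pairs from Jetchev–Skinner–Wan 2017 Thm. 1.2.1 (ss case PUB\*) to the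
# REFEREED one-sided print Sprung 2024 Cor. 1.3 (second sentence) + the per-pair datum `ord_p #Ш_an ≤ 0`:
# RECORD SHAPES on a literal integer equation (cell `bsd-litref`, paper sub-dir `jsw17`, seat `bsd-litref-jsw17-pv`;
# a `--supports stmt-BirchSwinnertonDyer-19000` helper file; closes nothing about the crux)

PARTITION (programme BSD-LIT2PART v1 §T2e «re-route consumers to the refereed statement; per-class re-derivation where
hypotheses narrow»): scoreboard row D2 = COVERED-literal C3-ss (semistable `E/ℚ`, good supersingular odd `p`, `r_an = 1`;
1 849 classes on the register `pub/bsd-ssimc/audit1/D2_jswss_classes.tsv`, 1 002 (class, `p ≥ 5`) rows on 977 classes), whose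
only closure of record is `Partition.RowC3.bsdp` through the named fact
`JetchevSkinnerWan2017.thm121_padicValRat_bsd_rank_one` carrying the flag `JSW-ss` (the printed proof of the supersingular
case imports then-unpublished inputs; audit `pub/bsd-ssimc/audit1-DAUDIT-1.md` §B.2). THE REFEREED STATEMENT re-routed to:
F. I. Sprung, Adv. Math. 449 (2024) 109741, Cor. 1.3, SECOND sentence — the UNCONDITIONAL inequality
`|L′(E,1)/(Reg·Ω)|_p ≤ |#Ш·∏c_ℓ/#E(ℚ)²_tor|_p` for square-free conductor and an odd supersingular `p` (tree fact
`Sprung2024.cor13_padicValRat_bsd_rank_one_le`, registry A96, typed VERBATIM; tier PUB with the provenance flags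
`Sprung24-Cor13-via-Kob13` / `KOB13-primary-unread` of record, D-audited by cell `bsd-cited` reader r18 2026-08-26 — WAKE
`pub-bsdpct-r4/WAKE-AUDIT-ARMP-r18-Sprung2024Cor13.md`, verdict VERBATIM, kernel reduction to the composed citation
`Kobayashi2013.rem13_…` in `Sprung2024/ChromaticRankOneOneSidedOfKato.lean`). Its X6 consumer is cell `b2b-bsdres`'s
`Supersingular.X6.bsdp_of_analyticRank_eq_one_of_shaAn_le` (`X6RankOneOneSided.lean`, p209700): in Miller's currency the
upper half `ord_p #Ш ≤ ord_p #Ш_an` plus the datum `ord_p #Ш_an ≤ 0` is the whole of `BSD(E,p)`. WHERE HYPOTHESES NARROW: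
the re-routed road needs, per pair, the exact value of `#Ш_an` as a `p`-adic unit (`#Ш_an ∈ {1, 4, 9, 16, …}` on every
D2 row, prime to every `p ≥ 5`; Cremona `allbsd`, the lane's value) — a DATA binder, as on every per-pair key the desk has
booked (pub-bsdpct/REFEREE.md ROUND 302, 302.2 (d)); nothing else: NO image hypothesis (square-free `N` discharges it in
print, Sprung p. 38), NO Tamagawa condition, NO auxiliary field.

THIS FILE: four RECORD SHAPES (theorems; compositions by name of cell `b2b-bsdres` kernel tools — x11c's bounded Kraus
minimality criterion `isGloballyMinimal_of_krausCriterion_bounded` / x11b3's `isGloballyMinimal_of_krausCriterion_support`, the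
schema point count `countPoints` through x10b's `countPointsFast` / `countPoints_eq_of_fast`, x10b's `classX6_of_intModel`
(`goodSS_of_intModel` + `SecondDescent.semistable_of_intModel_of_gcd_eq_one`), cc-eng-4's `classX6_three_of_intModel`,
`bsdp_of_missingUpperBoundAt_of_casselsTate_of_card_selmerGroup`) so that a per-pair record is ONE `exact` on the literal Cremona equation
`[a₁,a₂,a₃,a₄,a₆]` with every decidable side condition DECIDED in the kernel (`Δ ≠ 0`, minimality, `p ∤ Δ`, the point count
`#Ẽ(𝔽_p) = n` with `p ∣ p + 1 − n`, `gcd(Δ, c₄) = 1`) and EXACTLY the binders {`hS` Sprung 2024 Cor. 1.3 (ii), `hGZK`, `hmod`,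
`r_an = 1`, `#Ш_an = s` with `ord_p s ≤ 0`}: `X6RankOne.bsdp_of_cor13_of_ainvs_of_countPointsFast_of_shaAn_unit` (`p ≥ 5`),
`X6RankOne.bsdp_three_of_cor13_of_ainvs_of_countPointsFast_of_shaAn_unit` (`p = 3`, `#Ẽ(𝔽₃) = 4`, i.e. `a₃ = 0`),
`X6RankOne.bsdp_three_of_cor13_of_ainvs_of_countPointsFast_of_card_selmerGroup` (`p = 3`, `ord₃ #Ш_an ≤ 2` + the two-engine
count `9 ∣ #Sel^(3)`, Cassels–Tate for the lower half) and `X6RankOne.bsdp_of_cor13_of_ainvs_support_of_countPointsFast_of_shaAn_unit`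
(`p ≥ 5`, minimality from the support of `Δ`, no size bound). THEOREMS
ONLY; no definition, no named fact, no `sorry`; nothing is asserted about any curve; nothing booked; the tier of any record
through them is A96's tier (the desk's word). HONEST FRAMING: BSD is not proved by any of this; X6 stays CONSTRUCTION-SHAPED
class-wide (crux 2 of `Theses/SignedLowerHalves.lean` OPEN); JSW's theorem is neither used nor disputed here.

References: Sprung 2024 Cor. 1.3 [Sprung2024]; Kobayashi 2013 Cor. 1.3 [Kobayashi2013]; Silverman, *AEC* VII.1 Rem. 1.1,
VII.5 Prop. 5.1, VIII.8 [SilvermanAEC2009]; Kraus 1989 Prop. 1–2 [Kraus1989]; Ireland–Rosen Prop. 5.1.2 / §8.1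
[IrelandRosen1990]; Miller 2011 §1, Def. 1.1 [Miller2011LMS]; Cremona [Cremona2006].
-/

set_option autoImplicit false
set_option linter.dupNamespace false

noncomputable section

open scoped Classical

open WeierstrassCurve Literature.NumberTheory.EllipticCurves
  Literature.NumberTheory.EllipticCurves.Rank1Residual
  Literature.NumberTheory.EllipticCurves.Rank1Residual.Typed
  Literature.NumberTheory.EllipticCurves.Rank1Residual.X11RankOneCertificates
  Summit.BirchSwinnertonDyer.BirchSwinnertonDyer.Rank1Residual.IntModel
  Summit.BirchSwinnertonDyer.BirchSwinnertonDyer.Rank1Residual.X11RankOne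
  Summit.BirchSwinnertonDyer.Rank1Residual.X11b
  Summit.BirchSwinnertonDyer.Rank1Residual.Supersingular
  Summit.BirchSwinnertonDyer.Rank1Residual.SecondDescent

namespace Summit.BirchSwinnertonDyer.BirchSwinnertonDyer.Theorems.X6

/-- **RECORD SHAPE, `p ≥ 5` — the Sprung-road re-route of a D2 pair.** For an integer equation `[a₁,a₂,a₃,a₄,a₆]`
satisfying x11c's bounded Kraus/Silverman minimality criterion (kernel-decidable), a prime `p ≥ 5` with `p ∤ Δ` and the
fast schema count `countPointsFast [a₁,…,a₆] p = n`, `p ∣ p + 1 − n` (good SUPERSINGULAR at `p`), `gcd(Δ, c₄) = 1`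
(SEMISTABLE), and the binders `hS` (Sprung 2024 Cor. 1.3, second sentence — REFEREED, registry A96), `hGZK`, `hmod`,
`r_an = 1`, `#Ш_an = s` with `ord_p s ≤ 0`: **`BSD(E,p)`** — `IsElliptic`, `IsGloballyMinimal`, `ClassX6 W p` DERIVED in
the kernel, then `X6.bsdp_of_analyticRank_eq_one_of_shaAn_le`. No `JSW-ss` input, no image binder. Per pair; OFFER shape;
nothing booked. [cite: Sprung2024, Cor. 1.3 (p. 5), second sentence] [cite: SilvermanAEC2009, VII.1 Remark 1.1, VII.5 Prop. 5.1 and VIII.8]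
[cite: Kraus1989, Prop. 1 and Prop. 2] [cite: IrelandRosen1990, Prop. 5.1.2 and §8.1] [cite: Miller2011LMS, §1 and Def. 1.1] -/
theorem X6RankOne.bsdp_of_cor13_of_ainvs_of_countPointsFast_of_shaAn_unit (p : ℕ) [Fact p.Prime]
    (hS : Sprung2024.cor13_padicValRat_bsd_rank_one_le)
    (hGZK : rank_eq_analyticRank_of_analyticRank_le_one) (hmod : hasEntireLFunction_rat)
    (a1 a2 a3 a4 a6 : ℤ) (hp : 5 ≤ p)
    (hB : (discOf [a1, a2, a3, a4, a6]).natAbs < 512 ^ 12)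
    (hmin : ∀ q < 512, q < 2 ∨ ¬ q ^ 12 ∣ (discOf [a1, a2, a3, a4, a6]).natAbs ∨
      ¬ q ^ 4 ∣ (c4Of [a1, a2, a3, a4, a6]).natAbs ∨
      (q = 2 ∧ ¬ (2 : ℤ) ^ 8 ∣ c4Of [a1, a2, a3, a4, a6] ∧ (2 : ℤ) ^ 7 ∣ c6Of [a1, a2, a3, a4, a6]) ∨
      (q = 2 ∧ ¬ (2 : ℤ) ^ 24 ∣ discOf [a1, a2, a3, a4, a6] ∧ (512 : ℤ) ∣ c6Of [a1, a2, a3, a4, a6] ∧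
        (4 : ℤ) ∣ c6Of [a1, a2, a3, a4, a6] / 512 - 3) ∨
      (q = 3 ∧ (3 : ℤ) ^ 8 ∣ c6Of [a1, a2, a3, a4, a6] ∧ ¬ (3 : ℤ) ^ 9 ∣ c6Of [a1, a2, a3, a4, a6]))
    (hpΔ : ¬ (p : ℤ) ∣ discOf [a1, a2, a3, a4, a6]) {n : ℕ}
    (hc : countPointsFast [a1, a2, a3, a4, a6] p = n) (hap : (p : ℤ) ∣ (p : ℤ) + 1 - n)
    (hgcd : Int.gcd (discOf [a1, a2, a3, a4, a6]) (c4Of [a1, a2, a3, a4, a6]) = 1)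
    (hr : (⟨a1, a2, a3, a4, a6⟩ : WeierstrassCurve ℚ).analyticRank = 1)
    {s : ℚ} (hs : shaAn (⟨a1, a2, a3, a4, a6⟩ : WeierstrassCurve ℚ) = (s : ℂ))
    (hv : padicValRat p s ≤ 0) : BSDp (⟨a1, a2, a3, a4, a6⟩ : WeierstrassCurve ℚ) p := by
  have h0 : discOf [a1, a2, a3, a4, a6] ≠ 0 := fun h ↦ hpΔ (by rw [h]; exact dvd_zero _)
  haveI := isElliptic_of_discOf_ne_zero a1 a2 a3 a4 a6 h0
  haveI := isGloballyMinimal_of_krausCriterion_bounded a1 a2 a3 a4 a6 h0 hB hmin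
  have hI : integralModelInt (⟨a1, a2, a3, a4, a6⟩ : WeierstrassCurve ℚ) = ⟨a1, a2, a3, a4, a6⟩ :=
    integralModelInt_eq_of_map_eq _ (map_mk_int a1 a2 a3 a4 a6)
  have hp2 : p ≠ 2 := by omega
  have hX : ClassX6 (⟨a1, a2, a3, a4, a6⟩ : WeierstrassCurve ℚ) p :=
    classX6_of_intModel p hp hI (by rw [intCurve_Δ]; exact hpΔ)
      (natCard_point_eq_of_countPoints a1 a2 a3 a4 a6 p hp2 hpΔ (countPoints_eq_of_fast hc)) hap
      (by rw [intCurve_Δ, intCurve_c₄]; exact hgcd)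
  exact X6.bsdp_of_analyticRank_eq_one_of_shaAn_le _ p hS hGZK hmod hp2 hX hr ⟨s, hs, hv⟩

/-- **RECORD SHAPE, `p = 3` (the D2 rows with `a₃ = 0`) — the Sprung-road re-route at `3`.** As the `p ≥ 5` shape with
`countPointsFast [a₁,…,a₆] 3 = 4` (`a₃ = 0`: good supersingular at `3` AND the X6 clause at `p = 3`) and cc-eng-4's
`classX6_three_of_intModel`. Used only where the flag-free two-engine `3`-descent road has no EXACT row. Per pair; OFFER
shape; nothing booked. [cite: Sprung2024, Cor. 1.3 (p. 5), second sentence] [cite: SilvermanAEC2009, VII.1 Remark 1.1, VII.5 Prop. 5.1 and VIII.8]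
[cite: Kraus1989, Prop. 1 and Prop. 2] [cite: Miller2011LMS, §1 and Def. 1.1] -/
theorem X6RankOne.bsdp_three_of_cor13_of_ainvs_of_countPointsFast_of_shaAn_unit [Fact (Nat.Prime 3)]
    (hS : Sprung2024.cor13_padicValRat_bsd_rank_one_le)
    (hGZK : rank_eq_analyticRank_of_analyticRank_le_one) (hmod : hasEntireLFunction_rat)
    (a1 a2 a3 a4 a6 : ℤ)
    (hB : (discOf [a1, a2, a3, a4, a6]).natAbs < 512 ^ 12)
    (hmin : ∀ q < 512, q < 2 ∨ ¬ q ^ 12 ∣ (discOf [a1, a2, a3, a4, a6]).natAbs ∨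
      ¬ q ^ 4 ∣ (c4Of [a1, a2, a3, a4, a6]).natAbs ∨
      (q = 2 ∧ ¬ (2 : ℤ) ^ 8 ∣ c4Of [a1, a2, a3, a4, a6] ∧ (2 : ℤ) ^ 7 ∣ c6Of [a1, a2, a3, a4, a6]) ∨
      (q = 2 ∧ ¬ (2 : ℤ) ^ 24 ∣ discOf [a1, a2, a3, a4, a6] ∧ (512 : ℤ) ∣ c6Of [a1, a2, a3, a4, a6] ∧
        (4 : ℤ) ∣ c6Of [a1, a2, a3, a4, a6] / 512 - 3) ∨
      (q = 3 ∧ (3 : ℤ) ^ 8 ∣ c6Of [a1, a2, a3, a4, a6] ∧ ¬ (3 : ℤ) ^ 9 ∣ c6Of [a1, a2, a3, a4, a6]))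
    (h3Δ : ¬ (3 : ℤ) ∣ discOf [a1, a2, a3, a4, a6])
    (hc : countPointsFast [a1, a2, a3, a4, a6] 3 = 4)
    (hgcd : Int.gcd (discOf [a1, a2, a3, a4, a6]) (c4Of [a1, a2, a3, a4, a6]) = 1)
    (hr : (⟨a1, a2, a3, a4, a6⟩ : WeierstrassCurve ℚ).analyticRank = 1)
    {s : ℚ} (hs : shaAn (⟨a1, a2, a3, a4, a6⟩ : WeierstrassCurve ℚ) = (s : ℂ))
    (hv : padicValRat 3 s ≤ 0) : BSDp (⟨a1, a2, a3, a4, a6⟩ : WeierstrassCurve ℚ) 3 := by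
  have h0 : discOf [a1, a2, a3, a4, a6] ≠ 0 := fun h ↦ h3Δ (by rw [h]; exact dvd_zero _)
  haveI := isElliptic_of_discOf_ne_zero a1 a2 a3 a4 a6 h0
  haveI := isGloballyMinimal_of_krausCriterion_bounded a1 a2 a3 a4 a6 h0 hB hmin
  have hI : integralModelInt (⟨a1, a2, a3, a4, a6⟩ : WeierstrassCurve ℚ) = ⟨a1, a2, a3, a4, a6⟩ :=
    integralModelInt_eq_of_map_eq _ (map_mk_int a1 a2 a3 a4 a6)
  have hX : ClassX6 (⟨a1, a2, a3, a4, a6⟩ : WeierstrassCurve ℚ) 3 :=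
    classX6_three_of_intModel hI (by rw [intCurve_Δ]; exact h3Δ)
      (natCard_point_eq_of_countPoints a1 a2 a3 a4 a6 3 (by decide) h3Δ (countPoints_eq_of_fast hc))
      (by rw [intCurve_Δ, intCurve_c₄]; exact hgcd)
  exact X6.bsdp_of_analyticRank_eq_one_of_shaAn_le _ 3 hS hGZK hmod (by decide) hX hr ⟨s, hs, hv⟩

/-! ### The `#Ш_an = 9·u` shape at `p = 3` and the support-list minimality shape at `p ≥ 5` -/

/-- **RECORD SHAPE, `p = 3`, `ord₃ #Ш_an ≤ 2` + the descent COUNT `9 ∣ #Sel^(3)(E/ℚ)`** (the 24 D2 classes with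
`#Ш_an = 9`): UPPER half = Sprung 2024 Cor. 1.3 (ii) on X6 (`X6.missingUpperBoundAt_of_analyticRank_eq_one`, `hS`), LOWER
half = Cassels–Tate + the two-engine exact count `#Sel^(3)(E/ℚ) = 27 ⊇ 9` (`bsdp_of_missingUpperBoundAt_of_casselsTate_of_card_selmerGroup`,
cell `b2b-bsdres`; `3 ∤ #E(ℚ)_tors` from `E[3]` irreducible on X6, `ClassX6.irr`). Class and minimality DECIDED as in the
unit shape. Binders: `hS`, `hCT`, `hGZK`, `hmod`; data `hr`, `hs`/`hv` (`ord₃ s ≤ 2`); certificate `hcard`. Per pair; OFFER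
shape; nothing booked; tier = A96's (desk). [cite: Sprung2024, Cor. 1.3 (p. 5), second sentence]
[cite: SilvermanAEC2009, VII.1 Remark 1.1, VII.5 Prop. 5.1, VIII.8 and Thm. X.4.14] [cite: Kraus1989, Prop. 1 and Prop. 2] [cite: Miller2011LMS, §1 and Def. 1.1] -/
theorem X6RankOne.bsdp_three_of_cor13_of_ainvs_of_countPointsFast_of_card_selmerGroup [Fact (Nat.Prime 3)]
    (hS : Sprung2024.cor13_padicValRat_bsd_rank_one_le) (hCT : exists_casselsTate_pairing (K := ℚ))
    (hGZK : rank_eq_analyticRank_of_analyticRank_le_one) (hmod : hasEntireLFunction_rat)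
    (a1 a2 a3 a4 a6 : ℤ)
    (hB : (discOf [a1, a2, a3, a4, a6]).natAbs < 512 ^ 12)
    (hmin : ∀ q < 512, q < 2 ∨ ¬ q ^ 12 ∣ (discOf [a1, a2, a3, a4, a6]).natAbs ∨
      ¬ q ^ 4 ∣ (c4Of [a1, a2, a3, a4, a6]).natAbs ∨
      (q = 2 ∧ ¬ (2 : ℤ) ^ 8 ∣ c4Of [a1, a2, a3, a4, a6] ∧ (2 : ℤ) ^ 7 ∣ c6Of [a1, a2, a3, a4, a6]) ∨
      (q = 2 ∧ ¬ (2 : ℤ) ^ 24 ∣ discOf [a1, a2, a3, a4, a6] ∧ (512 : ℤ) ∣ c6Of [a1, a2, a3, a4, a6] ∧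
        (4 : ℤ) ∣ c6Of [a1, a2, a3, a4, a6] / 512 - 3) ∨
      (q = 3 ∧ (3 : ℤ) ^ 8 ∣ c6Of [a1, a2, a3, a4, a6] ∧ ¬ (3 : ℤ) ^ 9 ∣ c6Of [a1, a2, a3, a4, a6]))
    (h3Δ : ¬ (3 : ℤ) ∣ discOf [a1, a2, a3, a4, a6])
    (hc : countPointsFast [a1, a2, a3, a4, a6] 3 = 4)
    (hgcd : Int.gcd (discOf [a1, a2, a3, a4, a6]) (c4Of [a1, a2, a3, a4, a6]) = 1)
    (hr : (⟨a1, a2, a3, a4, a6⟩ : WeierstrassCurve ℚ).analyticRank = 1)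
    {s : ℚ} (hs : shaAn (⟨a1, a2, a3, a4, a6⟩ : WeierstrassCurve ℚ) = (s : ℂ)) (hv : padicValRat 3 s ≤ 2)
    (hcard : 3 ^ 2 ∣ Nat.card ((⟨a1, a2, a3, a4, a6⟩ : WeierstrassCurve ℚ).selmerGroup ((3 : ℕ) : ℤ))) :
    BSDp (⟨a1, a2, a3, a4, a6⟩ : WeierstrassCurve ℚ) 3 := by
  have h0 : discOf [a1, a2, a3, a4, a6] ≠ 0 := fun h ↦ h3Δ (by rw [h]; exact dvd_zero _)
  haveI := isElliptic_of_discOf_ne_zero a1 a2 a3 a4 a6 h0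
  haveI := isGloballyMinimal_of_krausCriterion_bounded a1 a2 a3 a4 a6 h0 hB hmin
  have hI : integralModelInt (⟨a1, a2, a3, a4, a6⟩ : WeierstrassCurve ℚ) = ⟨a1, a2, a3, a4, a6⟩ :=
    integralModelInt_eq_of_map_eq _ (map_mk_int a1 a2 a3 a4 a6)
  have hX : ClassX6 (⟨a1, a2, a3, a4, a6⟩ : WeierstrassCurve ℚ) 3 :=
    classX6_three_of_intModel hI (by rw [intCurve_Δ]; exact h3Δ)
      (natCard_point_eq_of_countPoints a1 a2 a3 a4 a6 3 (by decide) h3Δ (countPoints_eq_of_fast hc))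
      (by rw [intCurve_Δ, intCurve_c₄]; exact hgcd)
  have hirr : Irr (⟨a1, a2, a3, a4, a6⟩ : WeierstrassCurve ℚ) 3 := ClassX6.irr _ 3 (by decide) hX
  exact bsdp_of_missingUpperBoundAt_of_casselsTate_of_card_selmerGroup _ 3 hCT hGZK hr.le
    (not_dvd_torsionOrder_of_irr _ 3 hirr) hs hv (by rw [hr]; exact hcard)
    (X6.missingUpperBoundAt_of_analyticRank_eq_one _ 3 hS hGZK hmod (by decide) hX hr)

/-- **RECORD SHAPE, `p ≥ 5`, minimality from the SUPPORT of `Δ` (no size bound)** — for the D2 rows whose minimal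
discriminant exceeds `512¹²` (the bounded Kraus criterion's range): x11b3's `isGloballyMinimal_of_krausCriterion_support` on
a certificate list `bad = [(q, v_q N, v_q Δ), …]` with `|Δ| = ∏ q^{v_q Δ}` (on a semistable row every listed prime has
`q ∤ c₄`, so Silverman's disjunct holds); the rest as in the unit shape. Binders: `hS`, `hGZK`, `hmod`; data `hr`, `hs`/`hv`.
Per pair; OFFER shape; nothing booked; tier = A96's (desk). [cite: Sprung2024, Cor. 1.3 (p. 5), second sentence]
[cite: SilvermanAEC2009, VII.1 Remark 1.1, VII.5 Prop. 5.1 and VIII.8] [cite: Kraus1989, Prop. 1 and Prop. 2]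
[cite: IrelandRosen1990, Prop. 5.1.2 and §8.1] [cite: Miller2011LMS, §1 and Def. 1.1] -/
theorem X6RankOne.bsdp_of_cor13_of_ainvs_support_of_countPointsFast_of_shaAn_unit (p : ℕ) [Fact p.Prime]
    (hS : Sprung2024.cor13_padicValRat_bsd_rank_one_le)
    (hGZK : rank_eq_analyticRank_of_analyticRank_le_one) (hmod : hasEntireLFunction_rat)
    (a1 a2 a3 a4 a6 : ℤ) (hp : 5 ≤ p) (bad : List (ℕ × ℕ × ℕ)) (hprime : ∀ t ∈ bad, t.1.Prime)
    (hsupp : (discOf [a1, a2, a3, a4, a6]).natAbs = (bad.map fun t => t.1 ^ t.2.2).prod)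
    (h : ∀ t ∈ bad,
      (¬ (t.1 : ℤ) ^ 12 ∣ discOf [a1, a2, a3, a4, a6] ∨ ¬ (t.1 : ℤ) ^ 4 ∣ c4Of [a1, a2, a3, a4, a6]) ∨
      (t.1 = 2 ∧ (16 : ℤ) ∣ c4Of [a1, a2, a3, a4, a6] ∧ (64 : ℤ) ∣ c6Of [a1, a2, a3, a4, a6] ∧
        ¬ (((16 : ℤ) ∣ c4Of [a1, a2, a3, a4, a6] / 16 ∧
            ((32 : ℤ) ∣ c6Of [a1, a2, a3, a4, a6] / 64 ∨ (32 : ℤ) ∣ c6Of [a1, a2, a3, a4, a6] / 64 - 8)) ∨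
          (4 : ℤ) ∣ c6Of [a1, a2, a3, a4, a6] / 64 + 1)) ∨
      (t.1 = 3 ∧ (3 : ℤ) ^ 8 ∣ c6Of [a1, a2, a3, a4, a6] ∧ ¬ (3 : ℤ) ^ 9 ∣ c6Of [a1, a2, a3, a4, a6]))
    (hpΔ : ¬ (p : ℤ) ∣ discOf [a1, a2, a3, a4, a6]) {n : ℕ}
    (hc : countPointsFast [a1, a2, a3, a4, a6] p = n) (hap : (p : ℤ) ∣ (p : ℤ) + 1 - n)
    (hgcd : Int.gcd (discOf [a1, a2, a3, a4, a6]) (c4Of [a1, a2, a3, a4, a6]) = 1)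
    (hr : (⟨a1, a2, a3, a4, a6⟩ : WeierstrassCurve ℚ).analyticRank = 1)
    {s : ℚ} (hs : shaAn (⟨a1, a2, a3, a4, a6⟩ : WeierstrassCurve ℚ) = (s : ℂ))
    (hv : padicValRat p s ≤ 0) : BSDp (⟨a1, a2, a3, a4, a6⟩ : WeierstrassCurve ℚ) p := by
  have h0 : discOf [a1, a2, a3, a4, a6] ≠ 0 := fun h' ↦ hpΔ (by rw [h']; exact dvd_zero _)
  haveI := isElliptic_of_discOf_ne_zero a1 a2 a3 a4 a6 h0
  haveI := isGloballyMinimal_of_krausCriterion_support a1 a2 a3 a4 a6 bad hprime hsupp h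
  have hI : integralModelInt (⟨a1, a2, a3, a4, a6⟩ : WeierstrassCurve ℚ) = ⟨a1, a2, a3, a4, a6⟩ :=
    integralModelInt_eq_of_map_eq _ (map_mk_int a1 a2 a3 a4 a6)
  have hp2 : p ≠ 2 := by omega
  have hX : ClassX6 (⟨a1, a2, a3, a4, a6⟩ : WeierstrassCurve ℚ) p :=
    classX6_of_intModel p hp hI (by rw [intCurve_Δ]; exact hpΔ)
      (natCard_point_eq_of_countPoints a1 a2 a3 a4 a6 p hp2 hpΔ (countPoints_eq_of_fast hc)) hap
      (by rw [intCurve_Δ, intCurve_c₄]; exact hgcd)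
  exact X6.bsdp_of_analyticRank_eq_one_of_shaAn_le _ p hS hGZK hmod hp2 hX hr ⟨s, hs, hv⟩

/-! ### Appended: the support-list minimality shape at `p = 3` (the two D2@3 rows with `|Δ_min| ≥ 512¹²`) -/

/-- **RECORD SHAPE, `p = 3`, minimality from the SUPPORT of `Δ` (no size bound)** — the `p = 3` companion of
`X6RankOne.bsdp_of_cor13_of_ainvs_support_of_countPointsFast_of_shaAn_unit` for the D2@3 rows `301070ba1`, `460130i1` whose
minimal discriminant exceeds `512¹²`: x11b3's `isGloballyMinimal_of_krausCriterion_support` on a certificate list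
`bad = [(q, v_q N, v_q Δ), …]`, `countPointsFast [a₁,…,a₆] 3 = 4` (`a₃ = 0`), cc-eng-4's `classX6_three_of_intModel`, then
`X6.bsdp_of_analyticRank_eq_one_of_shaAn_le`. Binders: `hS`, `hGZK`, `hmod`; data `hr`, `hs`/`hv`. Per pair; OFFER shape; nothing
booked; tier = A96's (referee A ROUND 368: word (α), flag-free). [cite: Sprung2024, Cor. 1.3 (p. 5), second sentence]
[cite: SilvermanAEC2009, VII.1 Remark 1.1, VII.5 Prop. 5.1 and VIII.8] [cite: Kraus1989, Prop. 1 and Prop. 2] [cite: Miller2011LMS, §1 and Def. 1.1] -/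
theorem X6RankOne.bsdp_three_of_cor13_of_ainvs_support_of_countPointsFast_of_shaAn_unit [Fact (Nat.Prime 3)]
    (hS : Sprung2024.cor13_padicValRat_bsd_rank_one_le)
    (hGZK : rank_eq_analyticRank_of_analyticRank_le_one) (hmod : hasEntireLFunction_rat)
    (a1 a2 a3 a4 a6 : ℤ) (bad : List (ℕ × ℕ × ℕ)) (hprime : ∀ t ∈ bad, t.1.Prime)
    (hsupp : (discOf [a1, a2, a3, a4, a6]).natAbs = (bad.map fun t => t.1 ^ t.2.2).prod)
    (h : ∀ t ∈ bad,
      (¬ (t.1 : ℤ) ^ 12 ∣ discOf [a1, a2, a3, a4, a6] ∨ ¬ (t.1 : ℤ) ^ 4 ∣ c4Of [a1, a2, a3, a4, a6]) ∨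
      (t.1 = 2 ∧ (16 : ℤ) ∣ c4Of [a1, a2, a3, a4, a6] ∧ (64 : ℤ) ∣ c6Of [a1, a2, a3, a4, a6] ∧
        ¬ (((16 : ℤ) ∣ c4Of [a1, a2, a3, a4, a6] / 16 ∧
            ((32 : ℤ) ∣ c6Of [a1, a2, a3, a4, a6] / 64 ∨ (32 : ℤ) ∣ c6Of [a1, a2, a3, a4, a6] / 64 - 8)) ∨
          (4 : ℤ) ∣ c6Of [a1, a2, a3, a4, a6] / 64 + 1)) ∨
      (t.1 = 3 ∧ (3 : ℤ) ^ 8 ∣ c6Of [a1, a2, a3, a4, a6] ∧ ¬ (3 : ℤ) ^ 9 ∣ c6Of [a1, a2, a3, a4, a6]))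
    (h3Δ : ¬ (3 : ℤ) ∣ discOf [a1, a2, a3, a4, a6])
    (hc : countPointsFast [a1, a2, a3, a4, a6] 3 = 4)
    (hgcd : Int.gcd (discOf [a1, a2, a3, a4, a6]) (c4Of [a1, a2, a3, a4, a6]) = 1)
    (hr : (⟨a1, a2, a3, a4, a6⟩ : WeierstrassCurve ℚ).analyticRank = 1)
    {s : ℚ} (hs : shaAn (⟨a1, a2, a3, a4, a6⟩ : WeierstrassCurve ℚ) = (s : ℂ))
    (hv : padicValRat 3 s ≤ 0) : BSDp (⟨a1, a2, a3, a4, a6⟩ : WeierstrassCurve ℚ) 3 := by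
  have h0 : discOf [a1, a2, a3, a4, a6] ≠ 0 := fun h' ↦ h3Δ (by rw [h']; exact dvd_zero _)
  haveI := isElliptic_of_discOf_ne_zero a1 a2 a3 a4 a6 h0
  haveI := isGloballyMinimal_of_krausCriterion_support a1 a2 a3 a4 a6 bad hprime hsupp h
  have hI : integralModelInt (⟨a1, a2, a3, a4, a6⟩ : WeierstrassCurve ℚ) = ⟨a1, a2, a3, a4, a6⟩ :=
    integralModelInt_eq_of_map_eq _ (map_mk_int a1 a2 a3 a4 a6)
  have hX : ClassX6 (⟨a1, a2, a3, a4, a6⟩ : WeierstrassCurve ℚ) 3 :=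
    classX6_three_of_intModel hI (by rw [intCurve_Δ]; exact h3Δ)
      (natCard_point_eq_of_countPoints a1 a2 a3 a4 a6 3 (by decide) h3Δ (countPoints_eq_of_fast hc))
      (by rw [intCurve_Δ, intCurve_c₄]; exact hgcd)
  exact X6.bsdp_of_analyticRank_eq_one_of_shaAn_le _ 3 hS hGZK hmod (by decide) hX hr ⟨s, hs, hv⟩

end Summit.BirchSwinnertonDyer.BirchSwinnertonDyer.Theorems.X6

end
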